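import Mathlib
import HarnessLib
import Summits.HodgeConjecture.HodgeConjecture.Theses.KleimanBFSeeds
import Literature.AlgebraicGeometry.Motives.WeilSimilar
import Literature.AlgebraicGeometry.Motives.AbelianVarietyCohomologyExteriorH1
import Literature.AlgebraicGeometry.Motives.AbelianVarietyProjectiveChart
import Literature.AlgebraicGeometry.HodgeTheory.HolomorphicBundleChernCharacterTopDegree
import Literature.AlgebraicGeometry.HodgeTheory.MixedEllipticCurvesProductsHodgeClasses
import Literature.AlgebraicGeometry.HodgeTheory.SupportedClassesRational
import Literature.AlgebraicGeometry.HodgeTheory.AbelianVarietyEndomorphismsHOne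

/-!
# `WeilSimilarTrans` (stmt-HodgeConjecture-26054) holds — Weil-similarity is transitive through a
middle object of dimension `2n`

HONEST FRAMING: this closes the SUPPORT item `WeilSimilarTrans` of route `KleimanBFSeeds` (= stub
`stub_trans` of the registered skeleton `Lines/chosen-anchor` of the crux `KleimanSemiregularAnchor`,
stmt-HodgeConjecture-25931) and nothing more: it is linear algebra over the tree's rational-class API;
no case of the Hodge conjecture, no rung, no crux and no summit conjunct is proved here.

Statement. `Motives.IsWeilSimilar n P ψ h_P A φ h_A` (file `Motives/WeilSimilar.lean`) asks for
rational, `ℂ`-independent `4n`-frames of `H¹(P)` and `H¹(A)` in which `ψ^*`, `φ^*` have the SAME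
rational matrix `M` and the polarization pairings `Q_{h,2n-1}` have the SAME rational Gram matrix
`G` relative to non-zero rational top classes. If `(P₂, ψ₂, h₂) ~ (P₁, ψ₁, h₁)` and
`(P₁, ψ₁, h₁) ~ (A, φ, h_A)` with `dim P₁ = 2n`, then `(P₂, ψ₂, h₂) ~ (A, φ, h_A)`.

Proof (Deligne 1982, proof of Thm 4.8 / van Geemen 1994 Lemma 5.2, transposed to the carriers).
For `n = 0` all frames are empty and the statement is bookkeeping. For `n ≥ 1`: `b₁(P₁) = 2 dim P₁ =
4n` (`AbelianVariety.finrank_complexBetti_one`), so the two rational frames `v`, `v'` of `H¹(P₁)`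
are bases and the transition matrices `T` (`v' = T v`) and `S` (`v = S v'`) are RATIONAL
(`exists_rat_coords_of_isRationalClass_of_linearIndependent`) and mutually inverse; the top
cohomology `H^{4n}(P₁)` is a line (`finrank_complexBetti_two_mul_eq_one`), so the two rational top
classes differ by a non-zero rational `c`. Comparing the two expansions of `ψ₁^* v'` gives
`T Mᵀ = M'ᵀ T`, and of `Q(v'ᵢ, v'ⱼ)` gives `T G Tᵀ = c G'`. The new frame `w̃ = S w` on `A` is
rational and independent, `φ^*` acts on it by `M`, and its Gram matrix is `S G' Sᵀ = c⁻¹ G`, i.e.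
`G` relative to the rational top class `c⁻¹ ω_A`.
[cite: Deligne1982HodgeCycles, proof of Thm. 4.8 and Lemma 4.6] [cite: vanGeemen1994HodgeAV, Lemma 5.2]
-/

-- every declaration of this problem lives in `Summit.HodgeConjecture.HodgeConjecture.…` (summit = sub-problem)
set_option linter.dupNamespace false

noncomputable section

open CategoryTheory
open Literature.AlgebraicGeometry.Motives
open Literature.AlgebraicGeometry.HodgeTheory
open Literature.AlgebraicTopology.SingularHomology
open scoped Matrix

namespace Summit.HodgeConjecture.HodgeConjecture.Theorems

namespace WeilSimilarTrans

/-! ### Linear-algebra bookkeeping (frames, transition matrices, Gram matrices) -/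

section LinearAlgebra

variable {ι : Type*} [Fintype ι] {V W : Type*} [AddCommGroup V] [Module ℂ V]
  [AddCommGroup W] [Module ℂ W]

/-- Re-expanding a frame expansion through a second frame multiplies the coefficient matrices.
[folklore] -/
theorem sum_smul_sum_smul (T S : Matrix ι ι ℂ) (y : ι → V) (i : ι) :
    (∑ j, T i j • ∑ k, S j k • y k) = ∑ k, (T * S) i k • y k := by
  simp only [Finset.smul_sum, smul_smul, Matrix.mul_apply, Finset.sum_smul]
  rw [Finset.sum_comm]

/-- A vector of coefficients against a frame expansion: `Σᵢ gᵢ • Σₖ Sᵢₖ yₖ = Σₖ (g ᵥ* S)ₖ yₖ`.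
[folklore] -/
theorem sum_smul_sum_smul_vec (g : ι → ℂ) (S : Matrix ι ι ℂ) (y : ι → V) :
    (∑ i, g i • ∑ k, S i k • y k) = ∑ k, (Matrix.vecMul g S) k • y k := by
  simp only [Finset.smul_sum, smul_smul, Matrix.vecMul, dotProduct, Finset.sum_smul]
  rw [Finset.sum_comm]

/-- Coordinates with respect to a linearly independent family are unique. [folklore] -/
theorem coords_unique {v : ι → V} (hv : LinearIndependent ℂ v) (a b : ι → ℂ)
    (h : (∑ j, a j • v j) = ∑ j, b j • v j) : a = b := by
  have h0 : (∑ j, (a j - b j) • v j) = 0 := by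
    simp only [sub_smul, Finset.sum_sub_distrib, h, sub_self]
  funext j
  exact sub_eq_zero.1 (Fintype.linearIndependent_iff.1 hv _ h0 j)

/-- A family is its own expansion with the identity matrix. [folklore] -/
theorem sum_one_smul_eq [DecidableEq ι] (v : ι → V) (i : ι) : (∑ k, (1 : Matrix ι ι ℂ) i k • v k) = v i := by
  simp only [Matrix.one_apply, ite_smul, one_smul, zero_smul, Finset.sum_ite_eq, Finset.mem_univ,
    if_true]

/-- Gram matrix of a transformed frame: if `Q(vₖ, vₗ) = Gₖₗ • ω` then
`Q(Σₖ Tᵢₖ vₖ, Σₗ Tⱼₗ vₗ) = (T G Tᵀ)ᵢⱼ • ω`. [folklore] -/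
theorem gram_transform (Q : V →ₗ[ℂ] V →ₗ[ℂ] W) (v : ι → V) (G : Matrix ι ι ℂ) (ω : W)
    (hG : ∀ k l, Q (v k) (v l) = G k l • ω) (T : Matrix ι ι ℂ) (i j : ι) :
    Q (∑ k, T i k • v k) (∑ l, T j l • v l) = (T * G * Tᵀ) i j • ω := by
  have h1 : Q (∑ k, T i k • v k) (∑ l, T j l • v l) = ∑ k, ∑ l, (T j k * T i l * G l k) • ω := by
    simp only [map_sum, map_smul, LinearMap.sum_apply, LinearMap.smul_apply, hG, smul_smul,
      Finset.smul_sum]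
    exact Finset.sum_congr rfl fun k _ => Finset.sum_congr rfl fun l _ => by rw [mul_assoc]
  have h2 : (T * G * Tᵀ) i j = ∑ k, ∑ l, T j k * T i l * G l k := by
    simp only [Matrix.mul_apply, Matrix.transpose_apply, Finset.sum_mul]
    exact Finset.sum_congr rfl fun k _ => Finset.sum_congr rfl fun l _ => by ring
  rw [h1, h2, Finset.sum_smul]
  exact Finset.sum_congr rfl fun k _ => (Finset.sum_smul).symm

/-- A frame obtained from an independent frame by a matrix `S` with a right inverse `T`
(`S * T = 1`) is independent. [folklore] -/
theorem linearIndependent_transform [DecidableEq ι] {w : ι → V} (hw : LinearIndependent ℂ w)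
    (S T : Matrix ι ι ℂ)
    (hST : S * T = 1) : LinearIndependent ℂ (fun i => ∑ k, S i k • w k) := by
  rw [Fintype.linearIndependent_iff]
  intro g hg
  rw [sum_smul_sum_smul_vec] at hg
  have h0 : Matrix.vecMul g S = 0 := funext fun k => Fintype.linearIndependent_iff.1 hw _ hg k
  have : g = Matrix.vecMul (Matrix.vecMul g S) T := by
    rw [Matrix.vecMul_vecMul, hST, Matrix.vecMul_one]
  rw [this, h0, Matrix.zero_vecMul]
  exact fun _ => rfl

end LinearAlgebra

/-! ### Rational top classes on an abelian `2n`-fold differ by a non-zero rational -/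

/-- On an abelian variety `P₁` of dimension `2n`, `n ≥ 1`, two non-zero rational classes in the top
degree `2 + 2(2n-1) = 4n` differ by a non-zero RATIONAL factor (`H^{4n}(P₁(ℂ); ℂ)` is a line,
`finrank_complexBetti_two_mul_eq_one`; rational classes have rational coordinates,
`exists_rat_coords_of_isRationalClass_of_linearIndependent`). [folklore] -/
theorem exists_rat_smul_eq_of_top {n : ℕ} (hn : 0 < n) (P₁ : AbelianVariety ℂ) (hP : P₁.dim = 2 * n)
    {ω ω' : complexBetti P₁.X (2 + 2 * (2 * n - 1))} (hω : IsRationalClass ω) (hω0 : ω ≠ 0)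
    (hω' : IsRationalClass ω') (hω'0 : ω' ≠ 0) :
    ∃ c : ℚ, c ≠ 0 ∧ ω' = ((c : ℚ) : ℂ) • ω := by
  have htop : Module.finrank ℂ (complexBetti P₁.X (2 + 2 * (2 * n - 1))) = 1 := by
    have hdeg : 2 + 2 * (2 * n - 1) = 2 * P₁.dim := by omega
    rw [hdeg]
    exact finrank_complexBetti_two_mul_eq_one (AbelianVariety.isSmoothProjective_holds (A := P₁))
  haveI : FiniteDimensional ℂ (complexBetti P₁.X (2 + 2 * (2 * n - 1))) :=
    Module.finite_of_finrank_eq_succ htop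
  have hspan : Submodule.span ℂ (Set.range fun _ : Fin 1 => ω) = ⊤ := by
    rw [Set.range_const]
    exact Submodule.eq_top_of_finrank_eq (by rw [finrank_span_singleton hω0, htop])
  have hli : LinearIndependent ℂ (fun _ : Fin 1 => ω) := linearIndependent_unique_iff.2 hω0
  obtain ⟨r, hr⟩ := exists_rat_coords_of_isRationalClass_of_linearIndependent (fun _ => hω) hli hω'
    (by rw [hspan]; exact Submodule.mem_top)
  rw [Fin.sum_univ_one] at hr
  refine ⟨r 0, ?_, hr⟩
  rintro h0
  rw [h0, Rat.cast_zero, zero_smul] at hr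
  exact hω'0 hr

/-! ### Rational transition matrices between two rational frames of `H¹` -/

/-- On an abelian variety `P₁` of dimension `2n`, every rational class of `H¹(P₁(ℂ); ℂ)` has
RATIONAL coordinates in any rational, `ℂ`-independent `4n`-frame (`b₁ = 2 dim P₁ = 4n` makes the
frame a basis). [folklore] -/
theorem exists_rat_coords_frame {n : ℕ} (P₁ : AbelianVariety ℂ) (hP : P₁.dim = 2 * n)
    {v : Fin (4 * n) → complexBetti P₁.X 1} (hv : ∀ i, IsRationalClass (v i))
    (hvi : LinearIndependent ℂ v) {x : complexBetti P₁.X 1} (hx : IsRationalClass x) :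
    ∃ r : Fin (4 * n) → ℚ, x = ∑ j, ((r j : ℚ) : ℂ) • v j := by
  have hcard : Fintype.card (Fin (4 * n)) = Module.finrank ℂ (complexBetti P₁.X 1) := by
    rw [Fintype.card_fin, AbelianVariety.finrank_complexBetti_one, hP]; ring
  haveI : FiniteDimensional ℂ (complexBetti P₁.X 1) := finite_complexBetti_abelianVariety P₁ 1
  have hspan : Submodule.span ℂ (Set.range v) = ⊤ := hvi.span_eq_top_of_card_eq_finrank' hcard
  exact exists_rat_coords_of_isRationalClass_of_linearIndependent hv hvi hx
    (by rw [hspan]; exact Submodule.mem_top)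

/-! ### The transitivity theorem -/

/-- **Weil-similarity is transitive through a middle object of dimension `2n`** (the mathematical
content of `WeilSimilarTrans`, with the frames named): see the module docstring for the proof.
[cite: Deligne1982HodgeCycles, proof of Thm. 4.8 and Lemma 4.6] [cite: vanGeemen1994HodgeAV, Lemma 5.2] -/
theorem isWeilSimilar_trans {n : ℕ} {P₂ P₁ A : AbelianVariety ℂ} {ψ₂ : P₂ ⟶ P₂} {ψ₁ : P₁ ⟶ P₁}
    {φ : A ⟶ A} {h₂ : complexBetti P₂.X 2} {h₁ : complexBetti P₁.X 2} {hA : complexBetti A.X 2}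
    (hP : P₁.dim = 2 * n) (h21 : IsWeilSimilar n P₂ ψ₂ h₂ P₁ ψ₁ h₁)
    (h1A : IsWeilSimilar n P₁ ψ₁ h₁ A φ hA) : IsWeilSimilar n P₂ ψ₂ h₂ A φ hA := by
  obtain ⟨u, v, M, G, ω₂, ω₁, hu, hui, hv, hvi, hMu, hMv, hω₂, hω₂0, hω₁, hω₁0, hGu, hGv⟩ := h21
  obtain ⟨v', w, M', G', ω₁', ωA, hv', hv'i, hw, hwi, hM'v', hM'w, hω₁', hω₁'0, hωA, hωA0, hG'v',
    hG'w⟩ := h1A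
  rcases Nat.eq_zero_or_pos n with rfl | hn
  · -- `n = 0`: all frames are empty
    refine ⟨u, w, M, G, ω₂, ωA, hu, hui, hw, hwi, hMu, ?_, hω₂, hω₂0, hωA, hωA0, hGu, ?_⟩
    · intro i; exact Fin.elim0 (by simpa using i)
    · intro i; exact Fin.elim0 (by simpa using i)
  -- `n ≥ 1`. Rational transition matrices `T` (`v' = T v`) and `S` (`v = S v'`).
  choose T hT using fun i => exists_rat_coords_frame P₁ hP hv hvi (hv' i)
  choose S hS using fun i => exists_rat_coords_frame P₁ hP hv' hv'i (hv i)
  -- the ratio of the two rational top classes on `P₁`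
  obtain ⟨c, hc0, hc⟩ := exists_rat_smul_eq_of_top hn P₁ hP hω₁ hω₁0 hω₁' hω₁'0
  -- complex matrices
  set Tc : Matrix (Fin (4 * n)) (Fin (4 * n)) ℂ := fun i j => ((T i j : ℚ) : ℂ) with hTc
  set Sc : Matrix (Fin (4 * n)) (Fin (4 * n)) ℂ := fun i j => ((S i j : ℚ) : ℂ) with hSc
  set N : Matrix (Fin (4 * n)) (Fin (4 * n)) ℂ := fun i j => ((M j i : ℚ) : ℂ) with hN
  set N' : Matrix (Fin (4 * n)) (Fin (4 * n)) ℂ := fun i j => ((M' j i : ℚ) : ℂ) with hN'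
  set Gc : Matrix (Fin (4 * n)) (Fin (4 * n)) ℂ := fun i j => ((G i j : ℚ) : ℂ) with hGc
  set G'c : Matrix (Fin (4 * n)) (Fin (4 * n)) ℂ := fun i j => ((G' i j : ℚ) : ℂ) with hG'c
  have hT' : ∀ i, v' i = ∑ j, Tc i j • v j := fun i => by simpa only [hTc] using hT i
  have hS' : ∀ i, v i = ∑ j, Sc i j • v' j := fun i => by simpa only [hSc] using hS i
  have hMv_N : ∀ i, complexBetti.map ψ₁.hom.hom.hom 1 (v i) = ∑ j, N i j • v j := fun i => by
    simpa only [hN] using hMv i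
  have hM'v'_N : ∀ i, complexBetti.map ψ₁.hom.hom.hom 1 (v' i) = ∑ j, N' i j • v' j := fun i => by
    simpa only [hN'] using hM'v' i
  have hM'w_N : ∀ i, complexBetti.map φ.hom.hom.hom 1 (w i) = ∑ j, N' i j • w j := fun i => by
    simpa only [hN'] using hM'w i
  have hGv_c : ∀ k l, polarizationPairingOne P₁.X h₁ (2 * n - 1) (v k) (v l) = Gc k l • ω₁ :=
    fun k l => by simpa only [hGc] using hGv k l
  have hG'w_c : ∀ k l, polarizationPairingOne A.X hA (2 * n - 1) (w k) (w l) = G'c k l • ωA :=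
    fun k l => by simpa only [hG'c] using hG'w k l
  -- (I1) `S T = 1` and (I2) `T S = 1`
  have hST : Sc * Tc = 1 := by
    ext i k
    have h := hS' i
    simp only [hT', sum_smul_sum_smul] at h
    rw [← sum_one_smul_eq v i] at h
    exact congr_fun (coords_unique hvi _ _ h.symm) k
  have hTS : Tc * Sc = 1 := by
    ext i k
    have h := hT' i
    simp only [hS', sum_smul_sum_smul] at h
    rw [← sum_one_smul_eq v' i] at h
    exact congr_fun (coords_unique hv'i _ _ h.symm) k
  -- (I3) `T N = N' T` (two expansions of `ψ₁^* v'ᵢ` in the frame `v`)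
  have hTN : Tc * N = N' * Tc := by
    ext i k
    have h1 : complexBetti.map ψ₁.hom.hom.hom 1 (v' i) = ∑ k, (Tc * N) i k • v k := by
      rw [hT' i, map_sum]
      simp only [map_smul, hMv_N, sum_smul_sum_smul]
    have h2 : complexBetti.map ψ₁.hom.hom.hom 1 (v' i) = ∑ k, (N' * Tc) i k • v k := by
      rw [hM'v'_N i]
      simp only [hT', sum_smul_sum_smul]
    exact congr_fun (coords_unique hvi _ _ (h1.symm.trans h2)) k
  -- (I4) `T G Tᵀ = c G'` (two expansions of `Q(v'ᵢ, v'ⱼ)`)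
  have hTGT : Tc * Gc * Tcᵀ = (c : ℂ) • G'c := by
    ext i j
    have h1 : polarizationPairingOne P₁.X h₁ (2 * n - 1) (v' i) (v' j) = (Tc * Gc * Tcᵀ) i j • ω₁ := by
      rw [hT' i, hT' j]
      exact gram_transform _ v Gc ω₁ hGv_c Tc i j
    have h2 : polarizationPairingOne P₁.X h₁ (2 * n - 1) (v' i) (v' j) = ((c : ℂ) * G'c i j) • ω₁ := by
      rw [hG'v' i j, hc, smul_smul, mul_comm ((G' i j : ℚ) : ℂ)]
    have h12 := h1.symm.trans h2
    rw [Matrix.smul_apply, smul_eq_mul]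
    exact smul_left_injective ℂ hω₁0 h12
  -- derived: `N S = S N'` and `S G' Sᵀ = c⁻¹ G`
  have hNS : N * Sc = Sc * N' := by
    calc N * Sc = (Sc * Tc) * N * Sc := by rw [hST, Matrix.one_mul]
      _ = Sc * (Tc * N) * Sc := by simp only [Matrix.mul_assoc]
      _ = Sc * (N' * Tc) * Sc := by rw [hTN]
      _ = Sc * N' * (Tc * Sc) := by simp only [Matrix.mul_assoc]
      _ = Sc * N' := by rw [hTS, Matrix.mul_one]
  have hSGS : Sc * G'c * Scᵀ = ((c⁻¹ : ℚ) : ℂ) • Gc := by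
    have hcC : (c : ℂ) ≠ 0 := by exact_mod_cast hc0
    have h : (c : ℂ) • (Sc * G'c * Scᵀ) = Gc := by
      calc (c : ℂ) • (Sc * G'c * Scᵀ) = Sc * ((c : ℂ) • G'c) * Scᵀ := by
            rw [Matrix.mul_smul, Matrix.smul_mul]
        _ = Sc * (Tc * Gc * Tcᵀ) * Scᵀ := by rw [hTGT]
        _ = (Sc * Tc) * Gc * (Sc * Tc)ᵀ := by
            rw [Matrix.transpose_mul]
            simp only [Matrix.mul_assoc]
        _ = Gc := by rw [hST, Matrix.one_mul, Matrix.transpose_one, Matrix.mul_one]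
    rw [← h, smul_smul, Rat.cast_inv, inv_mul_cancel₀ hcC, one_smul]
  -- the new frame on `A`
  let w' : Fin (4 * n) → complexBetti A.X 1 := fun i => ∑ k, Sc i k • w k
  refine ⟨u, w', M, G, ω₂, ((c⁻¹ : ℚ) : ℂ) • ωA, hu, hui, ?_, ?_, hMu, ?_, hω₂, hω₂0, hωA.smul _,
    ?_, hGu, ?_⟩
  · -- rational
    intro i
    simpa only [w', hSc] using IsRationalClass.sum_smul Finset.univ hw (S i)
  · -- independent
    exact linearIndependent_transform hwi Sc Tc hST
  · -- `φ^*` acts by `M`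
    intro i
    have h1 : complexBetti.map φ.hom.hom.hom 1 (w' i) = ∑ k, (Sc * N') i k • w k := by
      show complexBetti.map φ.hom.hom.hom 1 (∑ k, Sc i k • w k) = _
      rw [map_sum]
      simp only [map_smul, hM'w_N, sum_smul_sum_smul]
    have h2 : (∑ j, ((M j i : ℚ) : ℂ) • w' j) = ∑ k, (N * Sc) i k • w k := by
      show (∑ j, N i j • ∑ k, Sc j k • w k) = _
      rw [sum_smul_sum_smul]
    rw [h1, h2, hNS]
  · -- non-zero top class
    exact smul_ne_zero (by exact_mod_cast inv_ne_zero hc0) hωA0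
  · -- Gram matrix
    intro i j
    show polarizationPairingOne A.X hA (2 * n - 1) (∑ k, Sc i k • w k) (∑ l, Sc j l • w l) = _
    rw [gram_transform _ w G'c ωA hG'w_c Sc i j, hSGS, Matrix.smul_apply, smul_eq_mul, ← smul_smul,
      smul_comm]

end WeilSimilarTrans

/-- **`WeilSimilarTrans` holds** (stmt-HodgeConjecture-26054; stub `stub_trans` of the registered
skeleton `Lines/chosen-anchor` of crux `KleimanSemiregularAnchor`): Weil-similarity
`Motives.IsWeilSimilar n` is transitive through a middle object of dimension `2n`.
[cite: Deligne1982HodgeCycles, proof of Thm. 4.8 and Lemma 4.6] [cite: vanGeemen1994HodgeAV, Lemma 5.2] -/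
theorem weilSimilarTrans_proof :
    Summit.HodgeConjecture.HodgeConjecture.Theses.KleimanBFSeeds.WeilSimilarTrans := by
  unfold Summit.HodgeConjecture.HodgeConjecture.Theses.KleimanBFSeeds.WeilSimilarTrans
  intro n P₂ P₁ A ψ₂ ψ₁ φ h₂ h₁ hA hP h21 h1A
  exact WeilSimilarTrans.isWeilSimilar_trans hP h21 h1A


end Summit.HodgeConjecture.HodgeConjecture.Theorems

end
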